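import Mathlib
import HarnessLib
import Summits.Ventures.LatticeQCDFlow.Exactness.NCMCGeneralSpaceRestartChainStartObservable
import Summits.Ventures.LatticeQCDFlow.Exactness.NCMCGeneralSpaceRestartChainVarianceFloor
import Summits.Ventures.LatticeQCDFlow.Exactness.NCMCGeneralSpaceMarkovErgodicCriteria
import Summits.Ventures.LatticeQCDFlow.Scoring.ChainTimeAverage
import Summits.Ventures.LatticeQCDFlow.Scoring.DoeblinAutocorrelation
import Summits.Ventures.LatticeQCDFlow.Scoring.VarianceOfTheMean

/-!
# NCMCGeneralSpaceRestartChainDilution — along the engine's restart chain only the START-EXPLAINED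
# part of a record observable is correlated: `C_G(t+1; R, P_F) = C_h(t+1; K, ν̄₀)` with
# `h = E[G | start]`, hence `Var(Σ_{i<N} G(εᵢ)) ≤ N·(Var_{P_F} G + 2(1/ε − 1)·Var_{ν̄₀} h)` —
# the variance-inflation factor of correlated launches is `1 + 2(1/ε − 1)·(Var h/Var G)`, not `2/ε − 1`

HONEST FRAMING: exact (Metropolis-corrected) sampling algorithms for lattice gauge theory;
figures of merit are autocorrelation/cost numbers at stated couplings and volumes; no
continuum-physics claim.

Venture `LatticeQCDFlow` (cell pub-lqcd); FANOUT row 19 (`su2-snf`, GEN-9: the `n_between` lever of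
the family-C protocol).  OUR WORK (bookkeeping over rows 8 / 11 / 13's kernel-level framework);
nothing is cited as a fact.  Row 8's DILUTION LAW (`Scoring/RestartChainAutocorrelation.autocov_restart_succ`,
stated there for the restart chain on `Ω × E` built with `Kernel.compProd`) says that the lag-`t ≥ 1`
autocovariances of a record observable are those of its CONDITIONAL MEAN GIVEN THE START along the
prior sampler; row 13's restart chain of a Crooks pair is the `E`-valued chain with kernel
`R = (κF ∘ₖ K).comap s` (`Exactness/NCMCGeneralSpaceMarkovRun`), for which row 13 proved the law for
observables OF THE START (`…RestartChainStartObservable.autocov_restartKernel_comp_start`).  This file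
states it for EVERY bounded record observable `G` in row 13's framework and draws the consequence
the sample-size files need: the variance of sums along the restart chain.

## Content (Crooks pair; `K` Markov; `R = (κF ∘ₖ K).comap s`; `P_F = fwdPathLaw ν₀ κF`;
## `ν̄₀ = Z₀⁻¹ν₀`; `G : E → ℝ` measurable with `|G| ≤ C`; `h(z) = ∫ G dκF(z, ·)`)

* `measurable_recordMean`, `abs_recordMean_le` — `h` is bounded measurable;
* **`CrooksPair.kop_restartKernel`** — `kop R G = (kop K h) ∘ s`: after one step the record is
  forgotten, only its start propagates; `CrooksPair.iterate_kop_restartKernel_succ` —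
  `(kop R)^[t+1] G = ((kop K)^[t+1] h) ∘ s`;
* **`CrooksPair.autocov_restartKernel_succ`** — THE LAW: `autocov R P_F G (t+1) = autocov K ν̄₀ h (t+1)`
  for every `t` (row 8's law in row 13's framework; `t = 0` is excluded: the lag-0 term carries the
  extra within-evolution variance);
* `CrooksPair.integral_recordMean_fwdPathLaw` (`∫ h dν̄₀ = ∫ G dP_F`),
  **`CrooksPair.variance_recordMean_le`** (`Var_{ν̄₀} h ≤ Var_{P_F} G`, Jensen);
* **`CrooksPair.variance_sum_restartChain_le_dilution`** — `K` `ν₀`-invariant with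
  `ε·ν̄₀(B) ≤ K(z, B)` for all `z` and measurable `B`, `ε > 0`: for the equilibrium restart chain and
  every `N`, `Var(Σ_{i<N} G(εᵢ)) ≤ N·(Var_{P_F} G + 2·(1/ε − 1)·Var_{ν̄₀} h)`;
  `…_le_of_dilution` — if `Var_{ν̄₀} h ≤ α·Var_{P_F} G` then `≤ (1 + 2α(1/ε − 1))·N·Var_{P_F} G`
  (`α = 1` always holds and gives back `(2/ε − 1)·N·Var_{P_F} G`, row 19's
  `Exactness/NCMCGeneralSpaceRestartChainSampleSize.chain_variance_sum_le_of_doeblin` applied to `R`).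

Reading (value-free): for the Jarzynski functional `G = e^{ΔF − W}` the fraction
`α = Var E[G | start]/Var G` is the part of the weight variance the launch configuration explains;
when the work is dominated by protocol noise (`α ≪ 1`) consecutive launches (`n_between` small) cost
almost nothing in effective sample size — the certified penalty is `1 + 2α(1/ε − 1)`, and
`Scaling/LaunchIntervalLaw` optimises the launch interval under exactly this envelope.  NOT CLAIMED:
`α` or `ε` for any concrete sampler/protocol; unbounded `G` (the sample-size files truncate).
-/

namespace Summit.Ventures.LatticeQCDFlow.Exactness.GeneralNCMC

open MeasureTheory ProbabilityTheory Set Filter Finset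
open scoped ENNReal

variable {Ω E : Type*} [MeasurableSpace Ω] [MeasurableSpace E]

/-! ## §1 The conditional mean given the start -/

/-- The record mean `h(z) = ∫ G dκF(z, ·)` of a measurable observable is measurable. -/
theorem measurable_recordMean (κF : Kernel Ω E) {G : E → ℝ} (hG : Measurable G) :
    Measurable fun z => ∫ ω, G ω ∂(κF z) :=
  (hG.stronglyMeasurable.integral_kernel (κ := κF)).measurable

/-- … and inherits the bound `|h| ≤ C` from `|G| ≤ C` (Markov `κF`). -/
theorem abs_recordMean_le (κF : Kernel Ω E) [IsMarkovKernel κF] {G : E → ℝ} {C : ℝ}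
    (hC : ∀ ω, |G ω| ≤ C) (z : Ω) : |∫ ω, G ω ∂(κF z)| ≤ C := by
  calc |∫ ω, G ω ∂(κF z)| = ‖∫ ω, G ω ∂(κF z)‖ := (Real.norm_eq_abs _).symm
    _ ≤ C * (κF z).real Set.univ := norm_integral_le_of_norm_le_const (Eventually.of_forall
        fun ω => by rw [Real.norm_eq_abs]; exact hC ω)
    _ = C := by rw [probReal_univ, mul_one]

namespace CrooksPair

variable {ν₀ ν₁ : Measure Ω} [IsFiniteMeasure ν₀] [IsFiniteMeasure ν₁] {κF κR : Kernel Ω E}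
  [IsMarkovKernel κF] [IsMarkovKernel κR] {s e : E → Ω} {W : E → ℝ}

omit [IsFiniteMeasure ν₀] [IsFiniteMeasure ν₁] [IsMarkovKernel κR] in
/-- **`kop R G = (kop K h) ∘ s`**, `h(z) = ∫ G dκF(z, ·)`: along the restart kernel a record
observable is replaced after one step by the conditional mean given the start, moved by `K`. -/
theorem kop_restartKernel (K : Kernel Ω Ω) [IsMarkovKernel K] (h : CrooksPair ν₀ ν₁ κF κR s e W)
    {G : E → ℝ} (hG : Measurable G) {C : ℝ} (hC : ∀ ω, |G ω| ≤ C) (ω : E) :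
    Scoring.kop ((κF ∘ₖ K).comap s h.measurable_s) G ω
      = Scoring.kop K (fun z => ∫ ω', G ω' ∂(κF z)) (s ω) := by
  simp only [Scoring.kop, Kernel.comap_apply]
  exact Kernel.integral_comp (Scoring.integrable_of_bounded _ hG hC)

omit [IsFiniteMeasure ν₀] [IsFiniteMeasure ν₁] [IsMarkovKernel κR] in
/-- Iterated: `(kop R)^[t+1] G = ((kop K)^[t+1] h) ∘ s`. -/
theorem iterate_kop_restartKernel_succ (K : Kernel Ω Ω) [IsMarkovKernel K]
    (h : CrooksPair ν₀ ν₁ κF κR s e W) {G : E → ℝ} (hG : Measurable G) {C : ℝ}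
    (hC : ∀ ω, |G ω| ≤ C) (t : ℕ) :
    (Scoring.kop ((κF ∘ₖ K).comap s h.measurable_s))^[t + 1] G
      = fun ω => (Scoring.kop K)^[t + 1] (fun z => ∫ ω', G ω' ∂(κF z)) (s ω) := by
  have h1 : Scoring.kop ((κF ∘ₖ K).comap s h.measurable_s) G
      = fun ω => Scoring.kop K (fun z => ∫ ω', G ω' ∂(κF z)) (s ω) :=
    funext (h.kop_restartKernel K hG hC)
  rw [Function.iterate_succ_apply, h1, Function.iterate_succ_apply]
  exact h.iterate_kop_restartKernel_comp_start K
    (Scoring.measurable_kop K (measurable_recordMean κF hG))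
    (Scoring.abs_kop_le K (abs_recordMean_le κF hC)) t

omit [IsFiniteMeasure ν₁] [IsMarkovKernel κR] in
/-- **THE DILUTION LAW (row 8's `autocov_restart_succ` in row 13's framework).**  For every bounded
measurable record observable `G` and every `t`:
`autocov R P_F G (t+1) = autocov K (Z₀⁻¹ν₀) h (t+1)`, `h(z) = ∫ G dκF(z, ·)`. -/
theorem autocov_restartKernel_succ (K : Kernel Ω Ω) [IsMarkovKernel K]
    (h : CrooksPair ν₀ ν₁ κF κR s e W) {G : E → ℝ} (hG : Measurable G) {C : ℝ}
    (hC : ∀ ω, |G ω| ≤ C) (t : ℕ) :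
    Scoring.autocov ((κF ∘ₖ K).comap s h.measurable_s) (fwdPathLaw ν₀ κF) G (t + 1)
      = Scoring.autocov K ((ν₀ univ)⁻¹ • ν₀) (fun z => ∫ ω, G ω ∂(κF z)) (t + 1) := by
  have hhm := measurable_recordMean κF hG
  have hhb := abs_recordMean_le κF hC
  obtain ⟨hum, hub⟩ := Scoring.iterate_kop_bounded_measurable K hhm hhb (t + 1)
  unfold Scoring.autocov
  rw [h.iterate_kop_restartKernel_succ K hG hC t]
  simp only
  rw [integral_fwdPathLaw_eq_integral_integral ν₀ κF
    (F := fun ω => G ω * (Scoring.kop K)^[t + 1] (fun z => ∫ ω', G ω' ∂(κF z)) (s ω))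
    (hG.mul (hum.comp h.measurable_s)) (C := C * C) (fun ω => by
      rw [abs_mul]
      exact mul_le_mul (hC ω) (hub _) (abs_nonneg _) ((abs_nonneg _).trans (hC ω)))]
  refine integral_congr_ae (Eventually.of_forall fun z => ?_)
  simp only
  rw [h.integral_start_eq (fun ω x => G ω *
    (Scoring.kop K)^[t + 1] (fun z => ∫ ω', G ω' ∂(κF z)) x) z, integral_mul_const]

omit [IsFiniteMeasure ν₁] [IsMarkovKernel κR] in
/-- `∫ h d(Z₀⁻¹ν₀) = ∫ G dP_F`: the record mean has the same mean. -/
theorem integral_recordMean_fwdPathLaw {G : E → ℝ} (hG : Measurable G) {C : ℝ}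
    (hC : ∀ ω, |G ω| ≤ C) :
    ∫ z, (∫ ω, G ω ∂(κF z)) ∂((ν₀ univ)⁻¹ • ν₀) = ∫ ω, G ω ∂(fwdPathLaw ν₀ κF) :=
  (integral_fwdPathLaw_eq_integral_integral ν₀ κF hG hC).symm

omit [IsFiniteMeasure ν₁] [IsMarkovKernel κR] in
/-- **JENSEN: `Var_{Z₀⁻¹ν₀} h ≤ Var_{P_F} G`** — conditioning on the start can only remove
variance; the removed part is the mean conditional variance of `G` given the launch point. -/
theorem variance_recordMean_le {G : E → ℝ} (hG : Measurable G) {C : ℝ}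
    (hC : ∀ ω, |G ω| ≤ C) :
    Var[fun z => ∫ ω, G ω ∂(κF z); (ν₀ univ)⁻¹ • ν₀] ≤ Var[G; fwdPathLaw ν₀ κF] := by
  set θ := ∫ ω, G ω ∂(fwdPathLaw ν₀ κF) with hθ
  have hhm := measurable_recordMean κF hG
  have hhb := abs_recordMean_le κF hC
  have hmean : ∫ z, (∫ ω, G ω ∂(κF z)) ∂((ν₀ univ)⁻¹ • ν₀) = θ :=
    integral_recordMean_fwdPathLaw hG hC
  -- centred observable and its record mean
  have hcm : Measurable fun ω => G ω - θ := hG.sub measurable_const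
  have hcb : ∀ ω, |G ω - θ| ≤ C + |θ| := fun ω => (abs_sub _ _).trans (add_le_add (hC ω) le_rfl)
  have hcsq : ∫ ω, (G ω - θ) ^ 2 ∂(fwdPathLaw ν₀ κF)
      = ∫ z, ∫ ω, (G ω - θ) ^ 2 ∂(κF z) ∂((ν₀ univ)⁻¹ • ν₀) :=
    integral_fwdPathLaw_eq_integral_integral ν₀ κF (hcm.pow_const 2) (C := (C + |θ|) ^ 2)
      (fun ω => by rw [abs_pow]; exact pow_le_pow_left₀ (abs_nonneg _) (hcb ω) 2)
  have hrec : ∀ z, ∫ ω, G ω ∂(κF z) - θ = ∫ ω, (G ω - θ) ∂(κF z) := fun z => by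
    rw [integral_sub (Scoring.integrable_of_bounded _ hG hC) (integrable_const _), integral_const,
      probReal_univ, one_smul]
  have hsqb : ∀ z, |∫ ω, (G ω - θ) ^ 2 ∂(κF z)| ≤ (C + |θ|) ^ 2 := fun z => by
    rw [abs_of_nonneg (integral_nonneg fun ω => sq_nonneg _)]
    calc ∫ ω, (G ω - θ) ^ 2 ∂(κF z) ≤ ∫ _ω, (C + |θ|) ^ 2 ∂(κF z) :=
          integral_mono_of_nonneg (Eventually.of_forall fun ω => sq_nonneg _)
            (integrable_const _) (Eventually.of_forall fun ω => by
              show (G ω - θ) ^ 2 ≤ (C + |θ|) ^ 2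
              calc (G ω - θ) ^ 2 = |G ω - θ| ^ 2 := (sq_abs _).symm
                _ ≤ (C + |θ|) ^ 2 := pow_le_pow_left₀ (abs_nonneg _) (hcb ω) 2)
      _ = (C + |θ|) ^ 2 := by rw [integral_const, probReal_univ, one_smul]
  rw [variance_eq_integral hhm.aemeasurable, variance_eq_integral hG.aemeasurable]
  change ∫ z, (∫ ω, G ω ∂(κF z) - ∫ z', (∫ ω, G ω ∂(κF z')) ∂((ν₀ univ)⁻¹ • ν₀)) ^ 2
      ∂((ν₀ univ)⁻¹ • ν₀) ≤ ∫ ω, (G ω - θ) ^ 2 ∂(fwdPathLaw ν₀ κF)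
  rw [hmean, hcsq]
  refine integral_mono_of_nonneg (Eventually.of_forall fun z => sq_nonneg _)
    (Scoring.integrable_of_bounded _
      ((hcm.pow_const 2).stronglyMeasurable.integral_kernel (κ := κF)).measurable hsqb)
    (Eventually.of_forall fun z => ?_)
  show (∫ ω, G ω ∂(κF z) - θ) ^ 2 ≤ ∫ ω, (G ω - θ) ^ 2 ∂(κF z)
  rw [hrec z]
  exact Scoring.sq_integral_le_integral_sq (κF z) hcm hcb

/-! ## §2 The variance of sums along the restart chain -/

omit [IsFiniteMeasure ν₁] [IsMarkovKernel κR] in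
/-- **THE VARIANCE OF SUMS ALONG THE RESTART CHAIN (dilution form).**  Crooks pair with `Z₀ ≠ 0`;
`K` Markov, `ν₀`-invariant and minorised by the normalised prior law, `ε·(Z₀⁻¹ν₀)(B) ≤ K(z, B)`
for all `z` and measurable `B`, `ε > 0`; `G` measurable with `|G| ≤ C`, `h(z) = ∫ G dκF(z, ·)`.
Along the equilibrium restart chain (`R = (κF ∘ₖ K).comap s` started in `P_F`), for every `N`:
`Var(Σ_{i<N} G(εᵢ)) ≤ N·(Var_{P_F} G + 2·(1/ε − 1)·Var_{Z₀⁻¹ν₀} h)`. -/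
theorem variance_sum_restartChain_le_dilution (K : Kernel Ω Ω) [IsMarkovKernel K]
    (h0 : ν₀ univ ≠ 0) (hK : Kernel.Invariant K ν₀) (h : CrooksPair ν₀ ν₁ κF κR s e W)
    {ε : ℝ≥0∞} (hε0 : 0 < ε)
    (hmin : ∀ z (B : Set Ω), MeasurableSet B → ε * ((ν₀ univ)⁻¹ • ν₀) B ≤ K z B)
    {G : E → ℝ} (hG : Measurable G) {C : ℝ} (hC : ∀ ω, |G ω| ≤ C) (N : ℕ) :
    haveI := isProbabilityMeasure_fwdPathLaw ν₀ h0 κF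
    Var[fun y : Fin N → E => ∑ i, G (y i);
        (Kernel.trajMeasure (X := fun _ : ℕ => E) (fwdPathLaw ν₀ κF)
          (fun n : ℕ => ((κF ∘ₖ K).comap s h.measurable_s).comap
            (fun hh : (j : ↥(Finset.Iic n)) → E => hh ⟨n, Finset.mem_Iic.2 le_rfl⟩)
            (measurable_pi_apply _))).map (fun (x : ℕ → E) (j : Fin N) => x j)]
      ≤ N * (Var[G; fwdPathLaw ν₀ κF]
          + 2 * (1 / ε.toReal - 1) * Var[fun z => ∫ ω, G ω ∂(κF z); (ν₀ univ)⁻¹ • ν₀]) := by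
  haveI := isProbabilityMeasure_fwdPathLaw ν₀ h0 κF
  haveI : IsProbabilityMeasure ((ν₀ univ)⁻¹ • ν₀) := by
    constructor
    rw [Measure.smul_apply, smul_eq_mul, ENNReal.inv_mul_cancel h0 (measure_ne_top _ _)]
  set R := (κF ∘ₖ K).comap s h.measurable_s with hR
  set π₀ := (ν₀ univ)⁻¹ • ν₀ with hπ₀
  set P := Kernel.trajMeasure (X := fun _ : ℕ => E) (fwdPathLaw ν₀ κF)
      (fun n : ℕ => R.comap (fun hh : (j : ↥(Finset.Iic n)) → E => hh ⟨n, Finset.mem_Iic.2 le_rfl⟩)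
        (measurable_pi_apply _)) with hP
  have hπR : Kernel.Invariant R (fwdPathLaw ν₀ κF) := h.invariant_restartKernel K hK
  have hπK : Kernel.Invariant K π₀ := invariant_smul K hK _
  -- the observable, its centring, its record mean
  set θ := ∫ ω, G ω ∂(fwdPathLaw ν₀ κF) with hθ
  set g := fun ω => G ω - θ with hg
  have hgm : Measurable g := hG.sub measurable_const
  have hgb : ∀ ω, |g ω| ≤ C + |θ| := fun ω => (abs_sub _ _).trans (add_le_add (hC ω) le_rfl)
  have hhm := measurable_recordMean κF hG
  have hhb := abs_recordMean_le κF hC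
  set hc := fun z => ∫ ω, g ω ∂(κF z) with hhc
  have hhcm : Measurable hc := measurable_recordMean κF hgm
  have hhcb : ∀ z, |hc z| ≤ C + |θ| := abs_recordMean_le κF hgb
  have hrec : ∀ z, hc z = ∫ ω, G ω ∂(κF z) - θ := fun z => by
    simp only [hhc, hg]
    rw [integral_sub (Scoring.integrable_of_bounded _ hG hC) (integrable_const _), integral_const,
      probReal_univ, one_smul]
  have hmean : ∫ z, (∫ ω, G ω ∂(κF z)) ∂π₀ = θ := integral_recordMean_fwdPathLaw hG hC
  have hhc0 : ∫ z, hc z ∂π₀ = 0 := by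
    simp_rw [hrec]
    rw [integral_sub (Scoring.integrable_of_bounded _ hhm hhb) (integrable_const _), hmean,
      integral_const, probReal_univ, one_smul, sub_self]
  have hvarh : ∫ z, hc z ^ 2 ∂π₀ = Var[fun z => ∫ ω, G ω ∂(κF z); π₀] := by
    rw [variance_eq_integral hhm.aemeasurable]
    refine integral_congr_ae (Eventually.of_forall fun z => ?_)
    simp only
    rw [hrec z, hmean]
  -- pass from `Fin N → E` to sums over `range N` on path space
  have hr : Measurable (fun (x : ℕ → E) (j : Fin N) => x j) :=
    measurable_pi_lambda _ fun j => measurable_pi_apply _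
  have hsumm : Measurable (fun y : Fin N → E => ∑ i, G (y i)) :=
    Finset.measurable_sum _ fun i _ => hG.comp (measurable_pi_apply i)
  rw [variance_map hsumm.aemeasurable hr.aemeasurable]
  have hcomp : ((fun y : Fin N → E => ∑ i, G (y i)) ∘ fun (x : ℕ → E) (j : Fin N) => x j)
      = fun x : ℕ → E => ∑ i ∈ range N, G (x i) := by
    funext x
    simp only [Function.comp_apply]
    exact Fin.sum_univ_eq_sum_range (fun i => G (x i)) N
  rw [hcomp]
  -- the variance of the sum through the lag covariances
  have hsum : Var[fun x : ℕ → E => ∑ i ∈ range N, G (x i); P]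
      = N * Scoring.autocov R (fwdPathLaw ν₀ κF) g 0
          + 2 * ∑ t ∈ range N, ((N : ℝ) - (t + 1))
            * Scoring.autocov R (fwdPathLaw ν₀ κF) g (t + 1) := by
    have hv := Scoring.variance_sum_range_of_cov_eq (μ := P) (fun i x => G (x i))
      (Scoring.autocov R (fwdPathLaw ν₀ κF) g) N
      (fun i _ => by rw [hP]; exact Scoring.chain_memLp (κ := R) (fwdPathLaw ν₀ κF) hG hC i)
      (fun i _ j _ => by rw [hP]; exact Scoring.chain_covariance (κ := R) hπR hG hC i j)
    rw [← hv]
    congr 1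
    funext x
    rw [Finset.sum_apply]
  -- lag 0: the full variance
  have hac0 : Scoring.autocov R (fwdPathLaw ν₀ κF) g 0 = Var[G; fwdPathLaw ν₀ κF] := by
    rw [Scoring.autocov_zero, variance_eq_integral hG.aemeasurable]
  -- lags ≥ 1: the record mean's autocovariances along `K`, under the Doeblin envelope
  have henv : ∀ t, |Scoring.autocov R (fwdPathLaw ν₀ κF) g (t + 1)|
      ≤ (1 - ε.toReal) ^ (t + 1) * Var[fun z => ∫ ω, G ω ∂(κF z); π₀] := fun t => by
    rw [hR, h.autocov_restartKernel_succ K hgm hgb t, ← hvarh]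
    exact Scoring.abs_autocov_le_of_doeblin hπK (fun x B hB => hmin x B hB) hhcm hhcb hhc0 (t + 1)
  have hε1 : ε ≤ 1 :=
    Scoring.eps_le_one_of_doeblin (κ := K) (π := π₀) (fun x B hB => hmin x B hB)
  have hεr0 : 0 < ε.toReal :=
    ENNReal.toReal_pos hε0.ne' (ne_top_of_le_ne_top ENNReal.one_ne_top hε1)
  have hl0 : 0 ≤ 1 - ε.toReal :=
    Scoring.one_sub_toReal_nonneg_of_doeblin (κ := K) (π := π₀) (fun x B hB => hmin x B hB)
  have hl1 : 1 - ε.toReal < 1 := by linarith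
  have habs : |1 - ε.toReal| < 1 := by rw [abs_of_nonneg hl0]; exact hl1
  have hgeo := Scoring.hasSum_geometric_succ habs
  have hVh0 : 0 ≤ Var[fun z => ∫ ω, G ω ∂(κF z); π₀] := variance_nonneg _ _
  have hNnn : (0 : ℝ) ≤ N := Nat.cast_nonneg N
  have hlag : ∑ t ∈ range N, ((N : ℝ) - (t + 1)) * Scoring.autocov R (fwdPathLaw ν₀ κF) g (t + 1)
      ≤ N * ((1 / ε.toReal - 1) * Var[fun z => ∫ ω, G ω ∂(κF z); π₀]) := by
    have hterm : ∀ t ∈ range N,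
        ((N : ℝ) - (t + 1)) * Scoring.autocov R (fwdPathLaw ν₀ κF) g (t + 1)
          ≤ N * ((1 - ε.toReal) ^ (t + 1) * Var[fun z => ∫ ω, G ω ∂(κF z); π₀]) := by
      intro t ht
      have ht' : (t : ℝ) + 1 ≤ N := by exact_mod_cast Finset.mem_range.1 ht
      have h1 : ((N : ℝ) - (t + 1)) * Scoring.autocov R (fwdPathLaw ν₀ κF) g (t + 1)
          ≤ ((N : ℝ) - (t + 1)) * |Scoring.autocov R (fwdPathLaw ν₀ κF) g (t + 1)| :=
        mul_le_mul_of_nonneg_left (le_abs_self _) (by linarith)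
      have h2 : ((N : ℝ) - (t + 1)) * |Scoring.autocov R (fwdPathLaw ν₀ κF) g (t + 1)|
          ≤ N * |Scoring.autocov R (fwdPathLaw ν₀ κF) g (t + 1)| :=
        mul_le_mul_of_nonneg_right (by linarith) (abs_nonneg _)
      exact h1.trans (h2.trans (mul_le_mul_of_nonneg_left (henv t) hNnn))
    refine (Finset.sum_le_sum hterm).trans ?_
    rw [← Finset.mul_sum, ← Finset.sum_mul]
    refine mul_le_mul_of_nonneg_left (mul_le_mul_of_nonneg_right ?_ hVh0) hNnn
    have hs := sum_le_hasSum (Finset.range N) (fun t _ => pow_nonneg hl0 (t + 1)) hgeo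
    have hε' : (1 - ε.toReal) / (1 - (1 - ε.toReal)) = 1 / ε.toReal - 1 := by
      rw [sub_sub_cancel, sub_div, div_self hεr0.ne']
    linarith
  rw [hsum, hac0]
  nlinarith [hlag]

omit [IsFiniteMeasure ν₁] [IsMarkovKernel κR] in
/-- **DILUTION FORM WITH A CONSTANT.**  If the start explains at most the fraction `α` of the
variance, `Var_{Z₀⁻¹ν₀} h ≤ α·Var_{P_F} G`, then `Var(Σ_{i<N} G(εᵢ)) ≤ (1 + 2α(1/ε − 1))·N·Var_{P_F} G`;
`α = 1` is always admissible (`variance_recordMean_le`) and gives the Doeblin factor `2/ε − 1`. -/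
theorem variance_sum_restartChain_le_of_dilution (K : Kernel Ω Ω) [IsMarkovKernel K]
    (h0 : ν₀ univ ≠ 0) (hK : Kernel.Invariant K ν₀) (h : CrooksPair ν₀ ν₁ κF κR s e W)
    {ε : ℝ≥0∞} (hε0 : 0 < ε)
    (hmin : ∀ z (B : Set Ω), MeasurableSet B → ε * ((ν₀ univ)⁻¹ • ν₀) B ≤ K z B)
    {G : E → ℝ} (hG : Measurable G) {C : ℝ} (hC : ∀ ω, |G ω| ≤ C) {α : ℝ}
    (hα : Var[fun z => ∫ ω, G ω ∂(κF z); (ν₀ univ)⁻¹ • ν₀] ≤ α * Var[G; fwdPathLaw ν₀ κF])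
    (N : ℕ) :
    haveI := isProbabilityMeasure_fwdPathLaw ν₀ h0 κF
    Var[fun y : Fin N → E => ∑ i, G (y i);
        (Kernel.trajMeasure (X := fun _ : ℕ => E) (fwdPathLaw ν₀ κF)
          (fun n : ℕ => ((κF ∘ₖ K).comap s h.measurable_s).comap
            (fun hh : (j : ↥(Finset.Iic n)) → E => hh ⟨n, Finset.mem_Iic.2 le_rfl⟩)
            (measurable_pi_apply _))).map (fun (x : ℕ → E) (j : Fin N) => x j)]
      ≤ (1 + 2 * α * (1 / ε.toReal - 1)) * N * Var[G; fwdPathLaw ν₀ κF] := by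
  haveI : IsProbabilityMeasure ((ν₀ univ)⁻¹ • ν₀) := by
    constructor
    rw [Measure.smul_apply, smul_eq_mul, ENNReal.inv_mul_cancel h0 (measure_ne_top _ _)]
  have key := h.variance_sum_restartChain_le_dilution K h0 hK hε0 hmin hG hC N
  have hε1 : ε ≤ 1 :=
    Scoring.eps_le_one_of_doeblin (κ := K) (π := (ν₀ univ)⁻¹ • ν₀) (fun x B hB => hmin x B hB)
  have hεr0 : 0 < ε.toReal :=
    ENNReal.toReal_pos hε0.ne' (ne_top_of_le_ne_top ENNReal.one_ne_top hε1)
  have hεr : ε.toReal ≤ 1 := by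
    have := ENNReal.toReal_mono ENNReal.one_ne_top hε1
    simpa using this
  have hfac : 0 ≤ 1 / ε.toReal - 1 := by
    rw [sub_nonneg, le_div_iff₀ hεr0]; linarith
  have hNnn : (0 : ℝ) ≤ N := Nat.cast_nonneg N
  refine key.trans ?_
  have h2 := mul_le_mul_of_nonneg_left hα (by positivity : (0:ℝ) ≤ 2 * (1 / ε.toReal - 1))
  have h3 := mul_le_mul_of_nonneg_left h2 hNnn
  nlinarith [h3]

omit [IsFiniteMeasure ν₁] [IsMarkovKernel κR] in
/-- **The Doeblin form recovered** (`α = 1`): `Var(Σ_{i<N} G(εᵢ)) ≤ (2/ε − 1)·N·Var_{P_F} G`. -/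
theorem variance_sum_restartChain_le_doeblin (K : Kernel Ω Ω) [IsMarkovKernel K]
    (h0 : ν₀ univ ≠ 0) (hK : Kernel.Invariant K ν₀) (h : CrooksPair ν₀ ν₁ κF κR s e W)
    {ε : ℝ≥0∞} (hε0 : 0 < ε)
    (hmin : ∀ z (B : Set Ω), MeasurableSet B → ε * ((ν₀ univ)⁻¹ • ν₀) B ≤ K z B)
    {G : E → ℝ} (hG : Measurable G) {C : ℝ} (hC : ∀ ω, |G ω| ≤ C) (N : ℕ) :
    haveI := isProbabilityMeasure_fwdPathLaw ν₀ h0 κF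
    Var[fun y : Fin N → E => ∑ i, G (y i);
        (Kernel.trajMeasure (X := fun _ : ℕ => E) (fwdPathLaw ν₀ κF)
          (fun n : ℕ => ((κF ∘ₖ K).comap s h.measurable_s).comap
            (fun hh : (j : ↥(Finset.Iic n)) → E => hh ⟨n, Finset.mem_Iic.2 le_rfl⟩)
            (measurable_pi_apply _))).map (fun (x : ℕ → E) (j : Fin N) => x j)]
      ≤ (2 / ε.toReal - 1) * N * Var[G; fwdPathLaw ν₀ κF] := by
  have key := h.variance_sum_restartChain_le_of_dilution K h0 hK hε0 hmin hG hC (α := 1)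
    (by rw [one_mul]; exact variance_recordMean_le hG hC) N
  have halg : (1 + 2 * (1:ℝ) * (1 / ε.toReal - 1)) = 2 / ε.toReal - 1 := by ring
  rwa [halg] at key

end CrooksPair

end Summit.Ventures.LatticeQCDFlow.Exactness.GeneralNCMC
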